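import Summits.HodgeConjecture.HodgeConjecture.Theorems.Ring2HypothesesAtlasSixfoldsAnchors
import Summits.HodgeConjecture.HodgeConjecture.Theorems.Ring2ClassTargetsRowsSixSevenWeilPullbacks
import Literature.AlgebraicGeometry.HodgeTheory.WeilClassesSquareDivisorPolynomial
import HarnessLib

/-!
# Ring 2 · hypotheses layer, part XIX — (G) `IsDivisorMultiWeilGenerated` VERSUS the Weil-PULL-BACK shape on rows `6, 7`

HONEST FRAMING (cell `pub-hodge-ring2`, verbatim): research route conditional on HC_CM; not a corollary;
Q11.4-sentence-2 already refuted in dim ≥ 3.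

`HC_CM` := `Theses.RankFourFaces.CMAbelianHodge` (stmt-HodgeConjecture-3052) does NOT occur in this file; no named
fact is used except, in ONE theorem, Weil's barrier fact `Weil1977_exceptionalHodgeClasses` AS A HYPOTHESIS. No
definition, no `sorry`. Typer 2 (hypotheses layer), gen 11, answering RING2-MAP §LEAD gen 8, L8.2 (b′).

THE QUESTION (b′). Two typed HYPOTHESIS SHAPES on a member `A` (never asserted; the cell's certificates for given
members live on the items):
* (G) `IsDivisorMultiWeilGenerated A` (part XIV): `B•(A) ⊗ ℂ ⊆ D•(A) ⊗ ℂ + Σ_k W_k ⊗ ℂ`, the sum `allWeilClasses A p`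
  running over the member's OWN imaginary-quadratic Weil structures `(φ, p, d)` — non-zero only in the middle degree
  `2p = dim A`;
* (P) typer 1's `Ring2.ClassTargets.IsWeilPullbackGenerated A` (p194357, in review — its module is not yet built,
  so it is NOT imported): the conjunction of
  (P₂) `IsCodimTwoGeneratedBy A (codimTwoWeilPullbacks A)`: `B² ⊗ ℂ ⊆ D² ⊗ ℂ + span (codimTwoWeilPullbacks A)`
  (André pull-backs of `(2,2)` Weil classes of Weil-type FOURFOLDS and of CM-FIELD Weil-type varieties of dimension
  `2e ≥ 8`), and (P₃) `IsCodimThreeProductGenerated A`: `B³ ⊗ ℂ ⊆ D³ ⊗ ℂ + span (B² ⌣ B¹)`.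
  Below (P₂) and (P₃) are WRITTEN OUT symbol for symbol as in typer 1's definitions, so that every theorem applies
  to `h : IsWeilPullbackGenerated A` as `h.1` / `h.2` by definitional unfolding once that module lands; nothing is
  re-defined here.
Which implication holds on the atlas Weil rows of dimensions `6, 7`, or which obstruction, by name?

THE ANSWER.
§1 LEMMA. If `B² ⊗ ℂ ⊆ D² ⊗ ℂ` then `span (B² ⌣ B¹) ⊆ D³ ⊗ ℂ` (bilinearity of `⌣` and the recursion defining divisor
   monomials, tree lemma `cupProduct_mem_divisorClassesSpan_succ`); so under `B² = D²` the clause (P₃) collapses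
   to `B³ ⊗ ℂ ⊆ D³ ⊗ ℂ`.
§2 SIXFOLDS. (G) forces `B² = D²` (there is no Weil structure of type `(2, ·)` on a sixfold: `allWeilClasses A 2 = 0`),
   hence (G) ⟹ (P₂) (`codimTwoGeneratedBy_of_isDivisorMultiWeilGenerated_of_dim_ne`, any seed set); and
   `(G) ∧ (P₃) ⟹ B = D` (`isDivisorGenerated_of_multiWeil_of_productClause_six`); conversely `B = D ⟹ (G) ∧ (P)`
   in every dimension. So ON A SIXFOLD `(G) ∧ (P) ⟺ (G) ∧ (P₃) ⟺ B(A) = D(A)`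
   (`isDivisorGenerated_iff_multiWeil_and_pullbackShape_six`): THE TWO SHAPES ARE TRANSVERSE — (G)'s only licence
   (the member's own codimension-3 Weil classes) is exactly what (P₃) forbids once `B² = D²` (`B² ⌣ B¹ = D² ⌣ D¹ ⊆
   D³`), and (P)'s only licence (codimension-2 pull-backs outside `D²`) is exactly what (G) forbids on a sixfold.
   NEITHER IMPLIES THE OTHER (§4), and where both hold HC is FREE (`hodgeConjectureFor_of_isDivisorGenerated`,
   van Geemen §2.4: Lefschetz `(1,1)` + products) — no `W₆`, no floor, no R3, no `HC_CM`.
§3 SEVENFOLDS (odd dimension). (G) ⟺ `B = D` (part XIV-B (A4′)) ⟹ (P₂) ∧ (P₃)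
   (`pullbackShape_of_isDivisorMultiWeilGenerated_of_odd_dim`). The converse is NOT claimed: a sevenfold with
   `B² ≠ D²` violates (G) (`not_isDivisorMultiWeilGenerated_of_exceptional_two`) and may satisfy (P) (candidates:
   products of the Moonen–Zarhin fourfolds (a)–(c) with a threefold — member-level, not certified here).
§4 THE OBSTRUCTIONS, BY NAME.
   (O1) (G) ⟹̸ (P) on sixfolds: `not_productClause_of_isDivisorMultiWeilGenerated_of_exceptional_three` — a sixfold
   satisfying (G) with ONE rational `(3,3)` class outside `D³ ⊗ ℂ` violates (P₃). Members (print): every abelian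
   sixfold of imaginary-quadratic Weil type general in its family — `Bᵖ = Dᵖ (p ≠ 3)`, `B³ = D³ ⊕ W_k`, `W_k ⊄ D³`
   [van Geemen Thm. 6.12, Thm. 4.11] — i.e. the generic members of atlas-2's three WEIL cells
   (`HodgeSexticFieldWeilSixfold`, `HodgeQuaternionSixfold`, `HodgeUnitaryThreefoldPair`, served in part XIV from
   (G) + `W₆`): their own Weil classes are of codimension `3`, neither divisor polynomials nor products
   `(2,2)·(1,1)` (`= D²·D¹` there) nor codimension-`2` anything — outside BOTH clauses of (P). In the kernel Weil's
   barrier fact (`n = 3`) yields a sixfold on which the CONJUNCTION `(G) ∧ (P₃)` fails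
   (`exists_six_not_multiWeil_and_productClause_of_weil1977`); that it is (P₃) which fails is Thm. 6.12 (print).
   (O2) (P) ⟹̸ (G) on sixfolds: `not_isDivisorMultiWeilGenerated_of_exceptional_two` — a 6- or 7-fold with ONE
   rational `(2,2)` class outside `D² ⊗ ℂ` violates (G), whatever else it satisfies (part XVII §4 has the all-degree
   form). Members: the K3-PARTNER sixfolds `Y × Z_Y` (`b₂ − d₂ = 4`, the four classes being CM-field Weil pull-backs:
   cell computation K3-WP + census, certified, NOT a tree theorem), which SATISFY (P) by the same computation
   (typer 1 §G4) — so (P) serves exactly the cell (G) cannot.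
§5 WHICH ROWS EACH SHAPE SERVES (dims `6, 7`; engines by name; every shape a HYPOTHESIS on the member).
   (G): engines `hodgeConjectureFor_of_multiWeilGenerated_of_weilSixfolds` (part XIV: (G) + `W₆`, or +
   `WeilClassesImaginaryQuadratic`) and, in dimension `7`, `B = D` for free (XIV-B (A4′) +
   `hodgeConjectureFor_of_isDivisorGenerated`); rows: the three Weil cells above, `E × Y₅`
   (`hodgeConjectureFor_prod_of_multiWeilGenerated_of_weilSixfolds`), the CM rows of parts XV–XVI, every `B = D`
   member; PRICE `W₆` (stmt-2524) = HC for the members' OWN Weil classes; NOT served: the K3 partners, `X × T` with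
   `X` a Moonen–Zarhin fourfold (`B² ≠ D²`, (O2)).
   (P): engine `Ring2.ClassTargets.hodgeConjectureFor_of_generated_of_seeds_algebraic` (typer 1, p194357: (P) +
   ALGEBRAIC seeds, `dim ≤ 7`); rows: the K3-partner cell `Ring2.Atlas.HodgeQuarticTypeIVFourfoldTimesCMSurface`,
   members whose extra classes are codimension-2 pull-backs; PRICE: Markman's floor fact (fourfold seeds) and
   `CodimTwoWeilClassesCMFieldOff` = R3's codimension-2 slice (CM-field seeds), or `HC_CM` + transport (typer 1
   readings (C)/(T)); NOT served: the generic Weil sixfolds (O1).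
   BOTH: the `B = D` members only (§2) — HC free, no price. NEITHER: e.g. a sixfold of Weil type `(φ, 3, d)` that
   ALSO carries an exceptional `(2,2)` pull-back (a Weil fourfold times a surface on which `k` acts with Weil
   signature): only the CENSUS ROWS X2′ ∧ X1 (all summands: divisors, products, lower-dimensional and Weil
   pull-backs) cover it — `Ring2.ClassTargets.mem_algebraicClasses_of_dim_le_seven_of_censusOff_weilPullbacks`
   with the floor and `W₆`. Both shapes imply the census CLAUSES of their member: (G) ⟹ X2′- and X1-clauses
   (part XVII §2), (P₂) ⟹ X2′-clause (typer 1 `codimTwoFromWeilPullbacks_clause_of_isCodimTwoGeneratedBy`),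
   (P₃) ⟹ X1-clause (`codimThreeWeilGeneration_clause_of_productClause` below) — the census is the common roof,
   (G) and (P) are the two pure member shapes under it.

What this file does NOT do: decide (G) or (P) for any member; prove `W₆`, the floor, R3 or `HC_CM`; touch any
route item. Honest column: linear algebra of the typed predicates plus one use of Weil's fact as a binder; the
member lists in §4–§5 are print (van Geemen 6.12 / 4.11, Moonen–Zarhin §5) or cell computation (K3-WP), labelled.

References: [cite: vanGeemen1994HodgeAV, §2.4–2.5, 4.9–4.11, Thm. 6.12] [cite: MoonenZarhin1999LowDim, Thm. 0.2
(e),(f), (2.7)–(2.8) and §5; arXiv:math/9901113] [cite: Weil1977HodgeRing] [cite: Andre1992HodgeCM, Théorème]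
[cite: VoisinHodgeI2002, Thm. 11.30] [cite: Deligne1982HodgeCycles, §4 Prop. 4.4]
-/

set_option linter.dupNamespace false

noncomputable section

open CategoryTheory
open Literature.AlgebraicGeometry Literature.AlgebraicGeometry.Motives
open Literature.AlgebraicGeometry.HodgeTheory
open Literature.AlgebraicTopology.SingularHomology
open Literature.Barriers.HodgeConjecture (divisorClassesSpan Weil1977_exceptionalHodgeClasses)
open Summit.HodgeConjecture.HodgeConjecture.Theses
open Summit.HodgeConjecture.HodgeConjecture.Ring2.ClassTargets

namespace Summit.HodgeConjecture.HodgeConjecture.Ring2.Hypotheses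

/-! ## §1 Under `B² = D²` the product summand `B² ⌣ B¹` of (P₃) is divisorial -/

/-- **`B² ⊗ ℂ ⊆ D² ⊗ ℂ ⟹ span (B² ⌣ B¹) ⊆ D³ ⊗ ℂ`.** The set is (P₃)'s / X1's product summand verbatim.
[cite: vanGeemen1994HodgeAV, §2.4] -/
theorem span_codimTwo_cup_codimOne_le_divisorClassesSpan_three {A : AbelianVariety ℂ}
    (h₂ : ∀ a : complexBetti A.X (2 * 2), IsRationalClass a → IsOfHodgeType A.dim A.X (2 * 2) 2 2 a →
      a ∈ divisorClassesSpan A.X A.dim 2) :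
    Submodule.span ℂ {w' : complexBetti A.X (2 * 3) |
        ∃ (a : complexBetti A.X (2 * 2)) (b : complexBetti A.X (2 * 1)),
          IsRationalClass a ∧ IsOfHodgeType A.dim A.X (2 * 2) 2 2 a ∧ IsRationalClass b ∧
          IsOfHodgeType A.dim A.X (2 * 1) 1 1 b ∧ w' = cupProduct (two_mul_add_two_mul 2 1) a b} ≤
      divisorClassesSpan A.X A.dim 3 := by
  refine Submodule.span_le.mpr ?_
  rintro w' ⟨a, b, ha, hat, hb, hbt, rfl⟩
  exact cupProduct_mem_divisorClassesSpan_succ (m := 2) _ (h₂ a ha hat) (Submodule.subset_span ⟨hb, hbt⟩)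

/-- Off the middle degree the sum of all Weil planes vanishes (part XVII §1 has the public form; kept private here
because part XVII is in review). [cite: vanGeemen1994HodgeAV, 4.9] -/
private theorem allWeilClasses_eq_bot_of_dim_ne_two_mul {A : AbelianVariety ℂ} {p : ℕ} (h : A.dim ≠ 2 * p) :
    allWeilClasses A p = ⊥ := by
  rw [allWeilClasses, iSup_eq_bot]
  rintro ⟨w, hw⟩
  exact absurd hw.dim_eq h

/-- **(G) off the middle degree is `Bᵖ ⊗ ℂ ⊆ Dᵖ ⊗ ℂ`** (e.g. `p = 2` on every 6- and 7-fold).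
[cite: vanGeemen1994HodgeAV, 4.9 and §2.4–2.5] -/
theorem mem_divisorClassesSpan_of_isDivisorMultiWeilGenerated_off_middle {A : AbelianVariety ℂ}
    (hG : IsDivisorMultiWeilGenerated A) {p : ℕ} (hp : A.dim ≠ 2 * p) {c : complexBetti A.X (2 * p)}
    (hc : IsRationalClass c) (hH : IsOfHodgeType A.dim A.X (2 * p) p p c) : c ∈ divisorClassesSpan A.X A.dim p := by
  simpa [allWeilClasses_eq_bot_of_dim_ne_two_mul hp] using hG p c hc hH

/-! ## §2 `B = D` gives both shapes; on a SIXFOLD (G) ∧ (P₃) gives `B = D` back -/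

/-- **`B = D ⟹ (P₂)` for ANY seed set `S`** (in particular `S = codimTwoWeilPullbacks A`).
[cite: vanGeemen1994HodgeAV, §2.4–2.5] -/
theorem codimTwoGeneratedBy_of_isDivisorGenerated {A : AbelianVariety ℂ} (h : IsDivisorGenerated A)
    (S : Set (complexBetti A.X (2 * 2))) :
    ∀ c : complexBetti A.X (2 * 2), IsRationalClass c → IsOfHodgeType A.dim A.X (2 * 2) 2 2 c →
      c ∈ divisorClassesSpan A.X A.dim 2 ⊔ Submodule.span ℂ S :=
  fun c hc hH ↦ Submodule.mem_sup_left (h 2 c hc hH)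

/-- **`B = D ⟹ (P₃)`** (the product summand is not needed). [cite: vanGeemen1994HodgeAV, §2.4–2.5] -/
theorem productClause_of_isDivisorGenerated {A : AbelianVariety ℂ} (h : IsDivisorGenerated A) :
    ∀ c : complexBetti A.X (2 * 3), IsRationalClass c → IsOfHodgeType A.dim A.X (2 * 3) 3 3 c →
      c ∈ divisorClassesSpan A.X A.dim 3 ⊔ Submodule.span ℂ {w' : complexBetti A.X (2 * 3) |
        ∃ (a : complexBetti A.X (2 * 2)) (b : complexBetti A.X (2 * 1)),
          IsRationalClass a ∧ IsOfHodgeType A.dim A.X (2 * 2) 2 2 a ∧ IsRationalClass b ∧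
          IsOfHodgeType A.dim A.X (2 * 1) 1 1 b ∧ w' = cupProduct (two_mul_add_two_mul 2 1) a b} :=
  fun c hc hH ↦ Submodule.mem_sup_left (h 3 c hc hH)

/-- **(G) ⟹ (P₂) off dimension `4`, for ANY seed set** — on a 6- or 7-fold (G) already gives `B² ⊗ ℂ ⊆ D² ⊗ ℂ`.
[cite: vanGeemen1994HodgeAV, 4.9] [cite: MoonenZarhin1999LowDim, Thm. 0.2 (e),(f)] -/
theorem codimTwoGeneratedBy_of_isDivisorMultiWeilGenerated_of_dim_ne {A : AbelianVariety ℂ} (hA : A.dim ≠ 2 * 2)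
    (hG : IsDivisorMultiWeilGenerated A) (S : Set (complexBetti A.X (2 * 2))) :
    ∀ c : complexBetti A.X (2 * 2), IsRationalClass c → IsOfHodgeType A.dim A.X (2 * 2) 2 2 c →
      c ∈ divisorClassesSpan A.X A.dim 2 ⊔ Submodule.span ℂ S :=
  fun _ hc hH ↦ Submodule.mem_sup_left (mem_divisorClassesSpan_of_isDivisorMultiWeilGenerated_off_middle hG hA hc hH)

/-- **SIXFOLDS: (G) ∧ (P₃) ⟹ `B(A) = D(A)`.** Degree `4`: (G) with `allWeilClasses A 2 = 0`; degree `6`: (P₃),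
whose product summand is divisorial by §1; every other degree: (G) off the middle degree.
[cite: vanGeemen1994HodgeAV, §2.4–2.5 and 4.9] [cite: MoonenZarhin1999LowDim, §5] -/
theorem isDivisorGenerated_of_multiWeil_of_productClause_six {A : AbelianVariety ℂ} (hA : A.dim = 6)
    (hG : IsDivisorMultiWeilGenerated A)
    (h₃ : ∀ c : complexBetti A.X (2 * 3), IsRationalClass c → IsOfHodgeType A.dim A.X (2 * 3) 3 3 c →
      c ∈ divisorClassesSpan A.X A.dim 3 ⊔ Submodule.span ℂ {w' : complexBetti A.X (2 * 3) |
        ∃ (a : complexBetti A.X (2 * 2)) (b : complexBetti A.X (2 * 1)),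
          IsRationalClass a ∧ IsOfHodgeType A.dim A.X (2 * 2) 2 2 a ∧ IsRationalClass b ∧
          IsOfHodgeType A.dim A.X (2 * 1) 1 1 b ∧ w' = cupProduct (two_mul_add_two_mul 2 1) a b}) :
    IsDivisorGenerated A := by
  have h2 : ∀ a : complexBetti A.X (2 * 2), IsRationalClass a → IsOfHodgeType A.dim A.X (2 * 2) 2 2 a →
      a ∈ divisorClassesSpan A.X A.dim 2 :=
    fun a ha hat ↦ mem_divisorClassesSpan_of_isDivisorMultiWeilGenerated_off_middle hG (by omega) ha hat
  intro p c hc hH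
  by_cases hp : p = 3
  · subst hp
    have hle : divisorClassesSpan A.X A.dim 3 ⊔ Submodule.span ℂ {w' : complexBetti A.X (2 * 3) |
        ∃ (a : complexBetti A.X (2 * 2)) (b : complexBetti A.X (2 * 1)),
          IsRationalClass a ∧ IsOfHodgeType A.dim A.X (2 * 2) 2 2 a ∧ IsRationalClass b ∧
          IsOfHodgeType A.dim A.X (2 * 1) 1 1 b ∧ w' = cupProduct (two_mul_add_two_mul 2 1) a b} ≤
        divisorClassesSpan A.X A.dim 3 :=
      sup_le le_rfl (span_codimTwo_cup_codimOne_le_divisorClassesSpan_three h2)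
    exact hle (h₃ c hc hH)
  · exact mem_divisorClassesSpan_of_isDivisorMultiWeilGenerated_off_middle hG (by omega) hc hH

/-- **SIXFOLDS: `B = D ⟺ (G) ∧ (P₃)`.** [cite: vanGeemen1994HodgeAV, §2.4–2.5, 4.9 and Thm. 6.12] -/
theorem isDivisorGenerated_iff_multiWeil_and_productClause_six {A : AbelianVariety ℂ} (hA : A.dim = 6) :
    IsDivisorGenerated A ↔ IsDivisorMultiWeilGenerated A ∧
      ∀ c : complexBetti A.X (2 * 3), IsRationalClass c → IsOfHodgeType A.dim A.X (2 * 3) 3 3 c →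
        c ∈ divisorClassesSpan A.X A.dim 3 ⊔ Submodule.span ℂ {w' : complexBetti A.X (2 * 3) |
          ∃ (a : complexBetti A.X (2 * 2)) (b : complexBetti A.X (2 * 1)),
            IsRationalClass a ∧ IsOfHodgeType A.dim A.X (2 * 2) 2 2 a ∧ IsRationalClass b ∧
            IsOfHodgeType A.dim A.X (2 * 1) 1 1 b ∧ w' = cupProduct (two_mul_add_two_mul 2 1) a b} :=
  ⟨fun h ↦ ⟨isDivisorMultiWeilGenerated_of_isDivisorGenerated h, productClause_of_isDivisorGenerated h⟩,
    fun h ↦ isDivisorGenerated_of_multiWeil_of_productClause_six hA h.1 h.2⟩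

/-- **SIXFOLDS: `B = D ⟺ (G) ∧ (P)`**, the right-hand conjunct being `IsWeilPullbackGenerated A` unfolded
(`IsCodimTwoGeneratedBy A (codimTwoWeilPullbacks A) ∧ IsCodimThreeProductGenerated A`). The two hypothesis shapes
are TRANSVERSE: jointly they leave no exceptional class at all. [cite: vanGeemen1994HodgeAV, §2.4–2.5 and Thm. 6.12]
[cite: MoonenZarhin1999LowDim, Thm. 0.2 (e),(f) and §5] [cite: Andre1992HodgeCM, Théorème] -/
theorem isDivisorGenerated_iff_multiWeil_and_pullbackShape_six {A : AbelianVariety ℂ} (hA : A.dim = 6) :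
    IsDivisorGenerated A ↔ IsDivisorMultiWeilGenerated A ∧
      ((∀ c : complexBetti A.X (2 * 2), IsRationalClass c → IsOfHodgeType A.dim A.X (2 * 2) 2 2 c →
          c ∈ divisorClassesSpan A.X A.dim 2 ⊔ Submodule.span ℂ (codimTwoWeilPullbacks A)) ∧
        ∀ c : complexBetti A.X (2 * 3), IsRationalClass c → IsOfHodgeType A.dim A.X (2 * 3) 3 3 c →
          c ∈ divisorClassesSpan A.X A.dim 3 ⊔ Submodule.span ℂ {w' : complexBetti A.X (2 * 3) |
            ∃ (a : complexBetti A.X (2 * 2)) (b : complexBetti A.X (2 * 1)),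
              IsRationalClass a ∧ IsOfHodgeType A.dim A.X (2 * 2) 2 2 a ∧ IsRationalClass b ∧
              IsOfHodgeType A.dim A.X (2 * 1) 1 1 b ∧ w' = cupProduct (two_mul_add_two_mul 2 1) a b}) :=
  ⟨fun h ↦ ⟨isDivisorMultiWeilGenerated_of_isDivisorGenerated h, codimTwoGeneratedBy_of_isDivisorGenerated h _,
      productClause_of_isDivisorGenerated h⟩,
    fun h ↦ isDivisorGenerated_of_multiWeil_of_productClause_six hA h.1 h.2.2⟩

/-- **Where both shapes hold on a sixfold, HC is FREE** (`B = D`, van Geemen §2.4: Lefschetz `(1,1)` + products) —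
no `W₆`, no floor, no R3, no `HC_CM`. [cite: vanGeemen1994HodgeAV, §2.4] [cite: VoisinHodgeI2002, Thm. 11.30] -/
theorem hodgeConjectureFor_of_multiWeil_of_productClause_six {A : AbelianVariety ℂ} (hA : A.dim = 6)
    (hG : IsDivisorMultiWeilGenerated A)
    (h₃ : ∀ c : complexBetti A.X (2 * 3), IsRationalClass c → IsOfHodgeType A.dim A.X (2 * 3) 3 3 c →
      c ∈ divisorClassesSpan A.X A.dim 3 ⊔ Submodule.span ℂ {w' : complexBetti A.X (2 * 3) |
        ∃ (a : complexBetti A.X (2 * 2)) (b : complexBetti A.X (2 * 1)),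
          IsRationalClass a ∧ IsOfHodgeType A.dim A.X (2 * 2) 2 2 a ∧ IsRationalClass b ∧
          IsOfHodgeType A.dim A.X (2 * 1) 1 1 b ∧ w' = cupProduct (two_mul_add_two_mul 2 1) a b}) :
    HodgeConjectureFor A.dim A.X :=
  hodgeConjectureFor_of_isDivisorGenerated A (isDivisorGenerated_of_multiWeil_of_productClause_six hA hG h₃)

/-! ## §3 Odd dimension (row `7`): (G) ⟹ (P) -/

/-- **In odd dimension (G) ⟹ (P₂) ∧ (P₃)** ((G) is `B = D` there, part XIV-B (A4′)). The converse is not claimed.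
[cite: vanGeemen1994HodgeAV, 4.9 and §2.4–2.5] [cite: MoonenZarhin1999LowDim, §3 (3.8) and §5] -/
theorem pullbackShape_of_isDivisorMultiWeilGenerated_of_odd_dim {A : AbelianVariety ℂ} (hA : Odd A.dim)
    (hG : IsDivisorMultiWeilGenerated A) :
    (∀ c : complexBetti A.X (2 * 2), IsRationalClass c → IsOfHodgeType A.dim A.X (2 * 2) 2 2 c →
        c ∈ divisorClassesSpan A.X A.dim 2 ⊔ Submodule.span ℂ (codimTwoWeilPullbacks A)) ∧
      ∀ c : complexBetti A.X (2 * 3), IsRationalClass c → IsOfHodgeType A.dim A.X (2 * 3) 3 3 c →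
        c ∈ divisorClassesSpan A.X A.dim 3 ⊔ Submodule.span ℂ {w' : complexBetti A.X (2 * 3) |
          ∃ (a : complexBetti A.X (2 * 2)) (b : complexBetti A.X (2 * 1)),
            IsRationalClass a ∧ IsOfHodgeType A.dim A.X (2 * 2) 2 2 a ∧ IsRationalClass b ∧
            IsOfHodgeType A.dim A.X (2 * 1) 1 1 b ∧ w' = cupProduct (two_mul_add_two_mul 2 1) a b} :=
  have hD := (isDivisorMultiWeilGenerated_iff_isDivisorGenerated_of_odd_dim hA).mp hG
  ⟨codimTwoGeneratedBy_of_isDivisorGenerated hD _, productClause_of_isDivisorGenerated hD⟩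

/-- **Row `7`: (G) ⟹ (P).** [cite: vanGeemen1994HodgeAV, 4.9] [cite: MoonenZarhin1999LowDim, §3 and §5] -/
theorem pullbackShape_of_isDivisorMultiWeilGenerated_seven {A : AbelianVariety ℂ} (hA : A.dim = 7)
    (hG : IsDivisorMultiWeilGenerated A) :
    (∀ c : complexBetti A.X (2 * 2), IsRationalClass c → IsOfHodgeType A.dim A.X (2 * 2) 2 2 c →
        c ∈ divisorClassesSpan A.X A.dim 2 ⊔ Submodule.span ℂ (codimTwoWeilPullbacks A)) ∧
      ∀ c : complexBetti A.X (2 * 3), IsRationalClass c → IsOfHodgeType A.dim A.X (2 * 3) 3 3 c →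
        c ∈ divisorClassesSpan A.X A.dim 3 ⊔ Submodule.span ℂ {w' : complexBetti A.X (2 * 3) |
          ∃ (a : complexBetti A.X (2 * 2)) (b : complexBetti A.X (2 * 1)),
            IsRationalClass a ∧ IsOfHodgeType A.dim A.X (2 * 2) 2 2 a ∧ IsRationalClass b ∧
            IsOfHodgeType A.dim A.X (2 * 1) 1 1 b ∧ w' = cupProduct (two_mul_add_two_mul 2 1) a b} :=
  pullbackShape_of_isDivisorMultiWeilGenerated_of_odd_dim ⟨3, by omega⟩ hG

/-! ## §4 The obstructions, by name -/

/-- **(O1) (G) ⟹̸ (P) on sixfolds: a (G)-sixfold with ONE `(3,3)` class outside `D³ ⊗ ℂ` violates (P₃).** Print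
members: every sixfold of imaginary-quadratic Weil type general in its family (`B³ = D³ ⊕ W_k`, `W_k ⊄ D³`,
`Bᵖ = Dᵖ` otherwise: van Geemen Thm. 6.12 / 4.11) — the generic members of atlas-2's three Weil cells; their own
Weil classes are of codimension `3`, outside both clauses of (P). [cite: vanGeemen1994HodgeAV, Thm. 6.12 and Thm. 4.11]
[cite: Weil1977HodgeRing] -/
theorem not_productClause_of_isDivisorMultiWeilGenerated_of_exceptional_three {A : AbelianVariety ℂ}
    (hA : A.dim = 6) (hG : IsDivisorMultiWeilGenerated A) {c : complexBetti A.X (2 * 3)} (hc : IsRationalClass c)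
    (hH : IsOfHodgeType A.dim A.X (2 * 3) 3 3 c) (hn : c ∉ divisorClassesSpan A.X A.dim 3) :
    ¬ ∀ c : complexBetti A.X (2 * 3), IsRationalClass c → IsOfHodgeType A.dim A.X (2 * 3) 3 3 c →
      c ∈ divisorClassesSpan A.X A.dim 3 ⊔ Submodule.span ℂ {w' : complexBetti A.X (2 * 3) |
        ∃ (a : complexBetti A.X (2 * 2)) (b : complexBetti A.X (2 * 1)),
          IsRationalClass a ∧ IsOfHodgeType A.dim A.X (2 * 2) 2 2 a ∧ IsRationalClass b ∧
          IsOfHodgeType A.dim A.X (2 * 1) 1 1 b ∧ w' = cupProduct (two_mul_add_two_mul 2 1) a b} :=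
  fun h₃ ↦ hn (isDivisorGenerated_of_multiWeil_of_productClause_six hA hG h₃ 3 c hc hH)

/-- **(O1) in the kernel, from Weil's barrier fact (`n = 3`)**: there is a sixfold on which the CONJUNCTION
`(G) ∧ (P₃)` fails (it carries a `(3,3)` class outside `D³ ⊗ ℂ`, and the conjunction would make its Hodge ring
divisorial). Which conjunct fails is print: for Weil's general sixfold (G) holds and (P₃) fails (Thm. 6.12).
[cite: vanGeemen1994HodgeAV, Thm. 4.11 and Thm. 6.12] [cite: Weil1977HodgeRing] -/
theorem exists_six_not_multiWeil_and_productClause_of_weil1977 (h : Weil1977_exceptionalHodgeClasses) :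
    ∃ A : AbelianVariety ℂ, A.dim = 6 ∧ ¬ (IsDivisorMultiWeilGenerated A ∧
      ∀ c : complexBetti A.X (2 * 3), IsRationalClass c → IsOfHodgeType A.dim A.X (2 * 3) 3 3 c →
        c ∈ divisorClassesSpan A.X A.dim 3 ⊔ Submodule.span ℂ {w' : complexBetti A.X (2 * 3) |
          ∃ (a : complexBetti A.X (2 * 2)) (b : complexBetti A.X (2 * 1)),
            IsRationalClass a ∧ IsOfHodgeType A.dim A.X (2 * 2) 2 2 a ∧ IsRationalClass b ∧
            IsOfHodgeType A.dim A.X (2 * 1) 1 1 b ∧ w' = cupProduct (two_mul_add_two_mul 2 1) a b}) := by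
  obtain ⟨A, hA, -, c, hc, hH, hn⟩ := h 3 (by norm_num)
  refine ⟨A, by omega, fun hGP ↦ hn ?_⟩
  have hmem := isDivisorGenerated_of_multiWeil_of_productClause_six (A := A) (by omega) hGP.1 hGP.2 3 c hc
    (by rw [hA]; exact hH)
  rwa [hA] at hmem

/-- **(O2) (P) ⟹̸ (G) on rows `6, 7`: ONE `(2,2)` class outside `D² ⊗ ℂ` kills (G)**, whatever else the member
satisfies — e.g. (P): the K3-partner sixfolds `Y × Z_Y` (`b₂ − d₂ = 4`, CM-field Weil pull-backs; cell
computation K3-WP, not a tree theorem) satisfy (P) and violate (G). [cite: MoonenZarhin1999LowDim, Thm. 0.2 (e),(f)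
and §5] [cite: vanGeemen1994HodgeAV, 4.9] -/
theorem not_isDivisorMultiWeilGenerated_of_exceptional_two {A : AbelianVariety ℂ} (hA : A.dim = 6 ∨ A.dim = 7)
    {c : complexBetti A.X (2 * 2)} (hc : IsRationalClass c) (hH : IsOfHodgeType A.dim A.X (2 * 2) 2 2 c)
    (hn : c ∉ divisorClassesSpan A.X A.dim 2) : ¬ IsDivisorMultiWeilGenerated A :=
  fun hG ↦ hn (mem_divisorClassesSpan_of_isDivisorMultiWeilGenerated_off_middle hG (by omega) hc hH)

/-- **(O2′) … even granted (P)**: on a sixfold, (P) together with one `(2,2)` class outside `D² ⊗ ℂ` is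
consistent only with `¬ (G)` — and then `B ≠ D`, so the member is NOT HC-free: it needs (P)'s price (the floor /
R3's codimension-2 slice / `HC_CM` + transport; typer 1 §G2–G3). [cite: MoonenZarhin1999LowDim, §5]
[cite: Andre1992HodgeCM, Théorème] -/
theorem not_isDivisorGenerated_of_exceptional_two {A : AbelianVariety ℂ} {c : complexBetti A.X (2 * 2)}
    (hc : IsRationalClass c) (hH : IsOfHodgeType A.dim A.X (2 * 2) 2 2 c) (hn : c ∉ divisorClassesSpan A.X A.dim 2) :
    ¬ IsDivisorGenerated A :=
  fun hD ↦ hn (hD 2 c hc hH)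

/-! ## §5 Both shapes sit under the census: (P₃) ⟹ the X1-clause (the X2′-clause from (P₂) is typer 1's) -/

/-- **(P₃) ⟹ the X1-clause of the member** (`Theses.SevenfoldWeilCensus.CodimThreeWeilGeneration` at `A`: (P₃) is
X1's first two summands). [cite: MoonenZarhin1999LowDim, (2.7)–(2.8) and §5] -/
theorem codimThreeWeilGeneration_clause_of_productClause {A : AbelianVariety ℂ}
    (h₃ : ∀ c : complexBetti A.X (2 * 3), IsRationalClass c → IsOfHodgeType A.dim A.X (2 * 3) 3 3 c →
      c ∈ divisorClassesSpan A.X A.dim 3 ⊔ Submodule.span ℂ {w' : complexBetti A.X (2 * 3) |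
        ∃ (a : complexBetti A.X (2 * 2)) (b : complexBetti A.X (2 * 1)),
          IsRationalClass a ∧ IsOfHodgeType A.dim A.X (2 * 2) 2 2 a ∧ IsRationalClass b ∧
          IsOfHodgeType A.dim A.X (2 * 1) 1 1 b ∧ w' = cupProduct (two_mul_add_two_mul 2 1) a b})
    (c : complexBetti A.X (2 * 3)) (hc : IsRationalClass c) (hH : IsOfHodgeType A.dim A.X (2 * 3) 3 3 c) :
    c ∈ divisorClassesSpan A.X A.dim 3 ⊔ Submodule.span ℂ {w' : complexBetti A.X (2 * 3) |
          ∃ (a : complexBetti A.X (2 * 2)) (b : complexBetti A.X (2 * 1)),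
            IsRationalClass a ∧ IsOfHodgeType A.dim A.X (2 * 2) 2 2 a ∧ IsRationalClass b ∧
            IsOfHodgeType A.dim A.X (2 * 1) 1 1 b ∧ w' = cupProduct (two_mul_add_two_mul 2 1) a b} ⊔
        Submodule.span ℂ {w' : complexBetti A.X (2 * 3) |
          ∃ (C : AbelianVariety ℂ) (g : A.X ⟶ C.X) (w : complexBetti C.X (2 * 3)), C.dim < A.dim ∧
            IsRationalClass w ∧ IsOfHodgeType C.dim C.X (2 * 3) 3 3 w ∧ w' = complexBetti.map g (2 * 3) w} ⊔
        Submodule.span ℂ {w' : complexBetti A.X (2 * 3) |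
          ∃ (B : AbelianVariety ℂ) (g : A.X ⟶ B.X) (d : ℕ) (ψ : B ⟶ B) (w : complexBetti B.X (2 * 3)),
            B.dim = 6 ∧ 0 < d ∧ ψ ≫ ψ = -(d • 𝟙 B) ∧ IsRationalClass w ∧
            IsOfHodgeType B.dim B.X (2 * 3) 3 3 w ∧ w ∈ weilClassesOf B ψ 3 d ∧
            w' = complexBetti.map g (2 * 3) w} :=
  Submodule.mem_sup_left (Submodule.mem_sup_left (h₃ c hc hH))

/-- **"(P₃) on every 6- and 7-fold" ⟹ X1** (route item stmt-18720, BY NAME; the hypothesis is NOT asserted).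
[cite: MoonenZarhin1999LowDim, (2.7)–(2.8) and §5] -/
theorem codimThreeWeilGeneration_of_forall_productClause
    (h : ∀ A : AbelianVariety ℂ, A.dim = 6 ∨ A.dim = 7 →
      ∀ c : complexBetti A.X (2 * 3), IsRationalClass c → IsOfHodgeType A.dim A.X (2 * 3) 3 3 c →
        c ∈ divisorClassesSpan A.X A.dim 3 ⊔ Submodule.span ℂ {w' : complexBetti A.X (2 * 3) |
          ∃ (a : complexBetti A.X (2 * 2)) (b : complexBetti A.X (2 * 1)),
            IsRationalClass a ∧ IsOfHodgeType A.dim A.X (2 * 2) 2 2 a ∧ IsRationalClass b ∧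
            IsOfHodgeType A.dim A.X (2 * 1) 1 1 b ∧ w' = cupProduct (two_mul_add_two_mul 2 1) a b}) :
    SevenfoldWeilCensus.CodimThreeWeilGeneration :=
  fun A hA c hc hH ↦ codimThreeWeilGeneration_clause_of_productClause (h A hA) c hc hH

/-- **Audit under `HodgeConjecture`**: rows `6` and `7` are on the HC path (typer 1's `hcOnClass_of_hodgeConjecture`);
the shapes (G), (P₂), (P₃) and `B = D` are census statements about the SHAPE of the member's Hodge ring, NOT
consequences of `HodgeConjecture`, and are never asserted in this file. [cite: Deligne2000, §1] -/
theorem multiWeilVsPullbacks_audit_of_hodgeConjecture (h : _root_.HodgeConjecture) : HCAtDim 6 ∧ HCAtDim 7 :=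
  ⟨hcOnClass_of_hodgeConjecture _ h, hcOnClass_of_hodgeConjecture _ h⟩

end Summit.HodgeConjecture.HodgeConjecture.Ring2.Hypotheses

end
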